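import Mathlib.Algebra.Polynomial.RuleOfSigns
import Mathlib.Algebra.Polynomial.EraseLead
import Mathlib.LinearAlgebra.Matrix.Determinant.Basic
import Mathlib.LinearAlgebra.Matrix.RowCol
import Mathlib.Analysis.Polynomial.Basic
import Mathlib.Topology.Algebra.Polynomial
import HarnessLib

/-!
# The generalized Vandermonde determinant `det [x_j^{α_i}]` is positive (Fischler–Sprang–Zudilin 2019, Lemma 4)

Topic `Literature/LinearAlgebra/Matrix`, namespace `Literature.LinearAlgebra.Matrix.GeneralizedVandermonde`.
Everything here is PROVED (no named facts).

Source: S. Fischler, J. Sprang, W. Zudilin, *Many odd zeta values are irrational*, Compositio Math. **155**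
(2019) 938–952 = arXiv:1803.08905 [FischlerSprangZudilin2019], §5 "A non-vanishing determinant" (held:
`paper:arxiv-1803.08905`, arXiv text): "**Lemma 4.** For `t ≥ 1`, let `x₁ < … < x_t` be positive real numbers
and `α₁ < … < α_t` non-negative integers. Then the generalized Vandermonde matrix `[x_j^{α_i}]_{1 ≤ i,j ≤ t}` has
positive determinant." ("The above result is quite classical and known to many people. While writing this paper
we have found various proofs of rather different nature, three given below" — a combinatorial one through Schur
polynomials, a linear-algebra one through Fekete's lemma, and an "Analytical proof … (see [GantmacherKrein]). By
induction on `t` one proves the following claim: A non-zero function `f(x) = Σ_{i=1}^t c_i x^{α_i}`, with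
`c_i, α_i ∈ ℝ`, has at most `t − 1` positive zeros. … The non-vanishing of the determinant in Lemma 4 is an
immediate consequence of this claim.") The lemma is the elimination step of [FischlerSprangZudilin2019, §6] and
of Lai–Yu 2020 (§5, "the following general Vandermonde matrix … `[b^j]_{b ∈ Ψ_B, j ∈ {1} ∪ J}` is invertible",
tree: `Literature/NumberTheory/Irrationality/LaiYu2020/NumberOfIrrationalOddZetaValues.lean`).

## The proof formalised here (the source's analytical proof, with Descartes' rule of signs for the zero count)
For NATURAL exponents `f = Σ c_i X^{α_i}` is a polynomial with at most `t` non-zero coefficients, so Descartes'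
rule of signs (Mathlib `Polynomial.roots_countP_pos_le_signVariations`) bounds its positive roots, counted with
multiplicity, by its sign variations `≤ t − 1` (`signVariations_le_card_support_sub_one`). Induction on `t`:
expanding `det [x_j^{α_i}]` along the last column gives a polynomial `g(X) = Σ_i ± (minor_i) X^{α_i}` with
`g(x_j) = 0` for `j < t` (two equal columns), `g(x_t) = det`, and leading coefficient the principal minor, positive
by induction; `g` has the `t − 1` positive roots `x₁, …, x_{t−1}` and no other, and `g → +∞`, so by the
intermediate value theorem `g > 0` on `(x_{t−1}, ∞) ∋ x_t`. (The source obtains positivity "from the positivity of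
the Vandermonde determinant" by continuity in the `α_i`; the induction above avoids real exponents.)

## Contents
* `genVandermonde x α` — the matrix `[x_j^{α_i}]` (rows indexed by the exponents, columns by the nodes), over any
  commutative ring;
* `countP_roots_pos_le` (a sum of `t` monomials has at most `t − 1` positive roots, with multiplicity; private
  helpers `signVariations_le_card_support_sub_one`, `card_le_countP_roots_pos`);
* **`det_genVandermonde_pos`** — Lemma 4 (for all `t`, including the empty determinant `= 1`), and
  `det_genVandermonde_ne_zero`.
-/

noncomputable section

open Polynomial Finset Filter

namespace Literature.LinearAlgebra.Matrix.GeneralizedVandermonde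

/-- The **generalized Vandermonde matrix** `[x_j^{α_i}]_{i,j}` of nodes `x : Fin t → R` and exponents
`α : Fin t → ℕ` (row index = exponent, column index = node, as printed).
[cite: FischlerSprangZudilin2019, §5 Lemma 4] -/
def genVandermonde {t : ℕ} {R : Type*} [CommRing R] (x : Fin t → R) (α : Fin t → ℕ) :
    Matrix (Fin t) (Fin t) R :=
  Matrix.of fun i j => x j ^ α i

/-- Entries of `genVandermonde`. [cite: FischlerSprangZudilin2019, §5 Lemma 4] -/
@[simp] theorem genVandermonde_apply {t : ℕ} {R : Type*} [CommRing R] (x : Fin t → R) (α : Fin t → ℕ)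
    (i j : Fin t) : genVandermonde x α i j = x j ^ α i := rfl

/-! ### Descartes' rule of signs ⇒ a sum of `t` monomials has at most `t − 1` positive roots -/

/-- The number of sign variations of a real polynomial is at most the number of its non-zero coefficients
minus one (private helper). [folklore] -/
private theorem signVariations_le_card_support_sub_one (P : ℝ[X]) : P.signVariations ≤ P.support.card - 1 := by
  induction h : P.support.card using Nat.strong_induction_on generalizing P with
  | _ k ih =>
    rcases Nat.lt_or_ge k 2 with hk | hk
    · obtain rfl | rfl : k = 0 ∨ k = 1 := by omega
      · have hP : P = 0 := by
          rw [Finset.card_eq_zero, Polynomial.support_eq_empty] at h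
          exact h
        subst hP
        simp
      · obtain ⟨d, c, hc, rfl⟩ := Polynomial.card_support_eq_one.mp h
        rw [Polynomial.C_mul_X_pow_eq_monomial, Polynomial.signVariations_monomial]
    · have hcard : P.eraseLead.support.card = k - 1 := by
        rw [Polynomial.card_support_eraseLead, h]
      have hih := ih (k - 1) (by omega) P.eraseLead hcard
      calc P.signVariations ≤ P.eraseLead.signVariations + 1 := Polynomial.signVariations_le_eraseLead_succ P
        _ ≤ k - 1 := by omega

/-- The "claim" of the analytical proof, for natural exponents and counted with multiplicity: a real polynomial
`Σ_{i < t} c_i X^{e_i}` has at most `t − 1` positive roots (Descartes' rule of signs).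
[cite: FischlerSprangZudilin2019, §5, analytical proof of Lemma 4 (claim)] -/
theorem countP_roots_pos_le {t : ℕ} (c : Fin t → ℝ) (e : Fin t → ℕ) :
    (∑ i, C (c i) * X ^ (e i) : ℝ[X]).roots.countP (0 < ·) ≤ t - 1 := by
  set P : ℝ[X] := ∑ i, C (c i) * X ^ (e i) with hP
  have hsupp : P.support ⊆ Finset.univ.image e := by
    intro d hd
    rw [Polynomial.mem_support_iff] at hd
    by_contra hnot
    apply hd
    rw [hP, Polynomial.finsetSum_coeff]
    refine Finset.sum_eq_zero fun i _ => ?_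
    rw [Polynomial.coeff_C_mul_X_pow]
    have : d ≠ e i := by
      intro hde
      exact hnot (Finset.mem_image.2 ⟨i, Finset.mem_univ _, hde.symm⟩)
    simp [this]
  have hcard : P.support.card ≤ t :=
    (Finset.card_le_card hsupp).trans (Finset.card_image_le.trans (by simp))
  calc P.roots.countP (0 < ·) ≤ P.signVariations := P.roots_countP_pos_le_signVariations
    _ ≤ P.support.card - 1 := signVariations_le_card_support_sub_one P
    _ ≤ t - 1 := by omega

/-- Distinct positive roots of a non-zero polynomial are counted by `roots.countP (0 < ·)` (private helper).
[folklore] -/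
private theorem card_le_countP_roots_pos {P : ℝ[X]} (hP : P ≠ 0) (S : Finset ℝ) (hpos : ∀ s ∈ S, 0 < s)
    (hroot : ∀ s ∈ S, P.IsRoot s) : S.card ≤ P.roots.countP (0 < ·) := by
  have hle : S.val ≤ P.roots := by
    rw [Multiset.le_iff_subset S.nodup]
    intro s hs
    exact (Polynomial.mem_roots hP).2 (hroot s hs)
  have hS : S.val.countP (0 < ·) = S.card := by
    rw [Finset.card_def]
    exact (Multiset.countP_eq_card).2 fun s hs => hpos s hs
  rw [← hS]
  exact Multiset.countP_le_of_le _ hle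

/-! ### Lemma 4 -/

/-- **Fischler–Sprang–Zudilin 2019, Lemma 4** (PROVED): for positive reals `x₁ < … < x_t` and natural numbers
`α₁ < … < α_t`, the generalized Vandermonde determinant `det [x_j^{α_i}]_{1 ≤ i,j ≤ t}` is positive (stated in
print for `t ≥ 1`; for `t = 0` the empty determinant is `1`). [cite: FischlerSprangZudilin2019, §5 Lemma 4] -/
theorem det_genVandermonde_pos :
    ∀ (t : ℕ) (x : Fin t → ℝ) (α : Fin t → ℕ), StrictMono x → (∀ j, 0 < x j) → StrictMono α →
      0 < (genVandermonde x α).det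
  | 0, x, α, _, _, _ => by simp [Matrix.det_fin_zero]
  | t + 1, x, α, hx, hx0, hα => by
    classical
    -- the principal minor is positive by induction
    have ih : 0 < (genVandermonde (fun j : Fin t => x (Fin.castSucc j)) (fun i : Fin t => α (Fin.castSucc i))).det :=
      det_genVandermonde_pos t _ _ (hx.comp Fin.strictMono_castSucc) (fun j => hx0 _)
        (hα.comp Fin.strictMono_castSucc)
    set M := genVandermonde x α with hM
    -- the signed minors along the last column and the polynomial `g`
    set m : Fin (t + 1) → ℝ := fun i => (-1) ^ ((i : ℕ) + t) * (M.submatrix i.succAbove Fin.castSucc).det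
      with hm
    set g : ℝ[X] := ∑ i, C (m i) * X ^ (α i) with hg
    -- evaluating `g` at `y` is the determinant with the last column replaced by `(y^{α_i})_i`
    have heval : ∀ y : ℝ, g.eval y = (M.updateCol (Fin.last t) fun i => y ^ α i).det := by
      intro y
      rw [Matrix.det_succ_column _ (Fin.last t), hg, Polynomial.eval_finsetSum]
      refine Finset.sum_congr rfl fun i _ => ?_
      have hsub : (M.updateCol (Fin.last t) fun i => y ^ α i).submatrix i.succAbove (Fin.last t).succAbove =
          M.submatrix i.succAbove Fin.castSucc := by
        ext a b
        simp [Matrix.submatrix_apply, Fin.succAbove_last]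
      rw [hsub, Matrix.updateCol_self]
      simp only [Polynomial.eval_mul, Polynomial.eval_C, Polynomial.eval_pow, Polynomial.eval_X, hm,
        Fin.val_last]
      ring
    -- `g(x_t) = det M`
    have heval_last : g.eval (x (Fin.last t)) = M.det := by
      rw [heval]
      congr 1
      ext i j
      by_cases hj : j = Fin.last t
      · subst hj; simp [hM]
      · simp [Matrix.updateCol_ne hj]
    -- `g(x_j) = 0` for `j < t` (two equal columns)
    have heval_cast : ∀ j : Fin t, g.eval (x (Fin.castSucc j)) = 0 := by
      intro j
      rw [heval]
      refine Matrix.det_zero_of_column_eq (Fin.castSucc_lt_last j).ne fun k => ?_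
      simp [hM]
    -- the leading coefficient of `g` is the principal minor
    have hmlast : m (Fin.last t) =
        (genVandermonde (fun j : Fin t => x (Fin.castSucc j)) (fun i : Fin t => α (Fin.castSucc i))).det := by
      simp only [hm, Fin.val_last, Fin.succAbove_last]
      have h1 : ((-1 : ℝ)) ^ (t + t) = 1 := by
        rw [← two_mul]; exact (Even.neg_one_pow (even_two_mul t))
      rw [h1, one_mul]
      rfl
    have hmlast_pos : 0 < m (Fin.last t) := hmlast ▸ ih
    set h : ℝ[X] := ∑ i : Fin t, C (m (Fin.castSucc i)) * X ^ (α (Fin.castSucc i)) with hh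
    have hg_split : g = h + C (m (Fin.last t)) * X ^ (α (Fin.last t)) := by
      rw [hg, Fin.sum_univ_castSucc]
    have hdeg_top : (C (m (Fin.last t)) * X ^ (α (Fin.last t)) : ℝ[X]).degree = α (Fin.last t) :=
      Polynomial.degree_C_mul_X_pow _ hmlast_pos.ne'
    have hdeg_h : h.degree < (C (m (Fin.last t)) * X ^ (α (Fin.last t)) : ℝ[X]).degree := by
      rw [hdeg_top, hh]
      refine lt_of_le_of_lt (Polynomial.degree_sum_le _ _) ?_
      rw [Finset.sup_lt_iff (by simp)]
      intro i _
      refine lt_of_le_of_lt (Polynomial.degree_C_mul_X_pow_le _ _) ?_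
      exact_mod_cast hα (Fin.castSucc_lt_last i)
    have hlead : g.leadingCoeff = m (Fin.last t) := by
      rw [hg_split, Polynomial.leadingCoeff_add_of_degree_lt hdeg_h, Polynomial.leadingCoeff_C_mul_X_pow]
    have hg0 : g ≠ 0 := by
      intro h0
      rw [h0, Polynomial.leadingCoeff_zero] at hlead
      exact hmlast_pos.ne' hlead.symm
    -- `g(y) > 0` for some `y > x_t`
    have hbig : ∃ y, x (Fin.last t) < y ∧ 0 < g.eval y := by
      by_cases hdeg : 0 < g.degree
      · have htend := g.tendsto_atTop_of_leadingCoeff_nonneg hdeg (hlead ▸ hmlast_pos.le)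
        obtain ⟨y, hy⟩ := ((htend.eventually_gt_atTop 0).and (eventually_gt_atTop (x (Fin.last t)))).exists
        exact ⟨y, hy.2, hy.1⟩
      · have hC : g = C (g.coeff 0) := Polynomial.eq_C_of_degree_le_zero (not_lt.1 hdeg)
        have hnat : g.natDegree = 0 := Polynomial.natDegree_eq_zero_iff_degree_le_zero.mpr (not_lt.1 hdeg)
        have hlc : g.leadingCoeff = g.coeff 0 := by rw [Polynomial.leadingCoeff, hnat]
        refine ⟨x (Fin.last t) + 1, by linarith, ?_⟩
        rw [hC, Polynomial.eval_C, ← hlc, hlead]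
        exact hmlast_pos
    obtain ⟨y, hxy, hgy⟩ := hbig
    have hinj : Function.Injective (fun j : Fin t => x (Fin.castSucc j)) := fun a b hab =>
      Fin.castSucc_injective t (hx.injective hab)
    -- no positive root other than `x₁, …, x_{t-1}`: `t` distinct positive roots already saturate Descartes
    have hcount : g.roots.countP (0 < ·) ≤ t := by
      have := countP_roots_pos_le m α
      rw [← hg] at this
      simpa using this
    -- conclude by the intermediate value theorem
    rw [← heval_last]
    by_contra hle
    push Not at hle
    have hlt : g.eval (x (Fin.last t)) < 0 := by
      rcases hle.lt_or_eq with hlt | heq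
      · exact hlt
      · -- `g(x_t) = 0` would give `t + 1` distinct positive roots
        exfalso
        set S : Finset ℝ := insert (x (Fin.last t)) (Finset.univ.image fun j : Fin t => x (Fin.castSucc j))
          with hS
        have hnot : x (Fin.last t) ∉ Finset.univ.image fun j : Fin t => x (Fin.castSucc j) := by
          intro hmem
          obtain ⟨j, _, hj⟩ := Finset.mem_image.1 hmem
          exact (hx (Fin.castSucc_lt_last j)).ne hj
        have hScard : S.card = t + 1 := by
          rw [hS, Finset.card_insert_of_notMem hnot, Finset.card_image_of_injective _ hinj]
          simp
        have hSle := card_le_countP_roots_pos hg0 S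
          (fun s hs => by
            rcases Finset.mem_insert.1 hs with rfl | hs
            · exact hx0 _
            · obtain ⟨j, _, rfl⟩ := Finset.mem_image.1 hs; exact hx0 _)
          (fun s hs => by
            rcases Finset.mem_insert.1 hs with rfl | hs
            · exact heq
            · obtain ⟨j, _, rfl⟩ := Finset.mem_image.1 hs; exact heval_cast j)
        omega
    obtain ⟨z, hz, hz0⟩ : ∃ z ∈ Set.Ioo (x (Fin.last t)) y, g.eval z = 0 := by
      have hivt := intermediate_value_Ioo hxy.le (g.continuous.continuousOn (s := Set.Icc (x (Fin.last t)) y))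
      exact hivt ⟨hlt, hgy⟩
    set S : Finset ℝ := insert z (Finset.univ.image fun j : Fin t => x (Fin.castSucc j)) with hS
    have hnot : z ∉ Finset.univ.image fun j : Fin t => x (Fin.castSucc j) := by
      intro hmem
      obtain ⟨j, _, hj⟩ := Finset.mem_image.1 hmem
      have := hx (Fin.castSucc_lt_last j)
      rw [hj] at this
      exact (lt_trans this hz.1).false
    have hScard : S.card = t + 1 := by
      rw [hS, Finset.card_insert_of_notMem hnot, Finset.card_image_of_injective _ hinj]
      simp
    have hzpos : 0 < z := lt_trans (hx0 _) hz.1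
    have hSle := card_le_countP_roots_pos hg0 S
      (fun s hs => by
        rcases Finset.mem_insert.1 hs with rfl | hs
        · exact hzpos
        · obtain ⟨j, _, rfl⟩ := Finset.mem_image.1 hs; exact hx0 _)
      (fun s hs => by
        rcases Finset.mem_insert.1 hs with rfl | hs
        · exact hz0
        · obtain ⟨j, _, rfl⟩ := Finset.mem_image.1 hs; exact heval_cast j)
    omega

/-- The generalized Vandermonde matrix of Lemma 4 is invertible (non-zero determinant).
[cite: FischlerSprangZudilin2019, §5 Lemma 4] -/
theorem det_genVandermonde_ne_zero {t : ℕ} {x : Fin t → ℝ} {α : Fin t → ℕ} (hx : StrictMono x)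
    (hx0 : ∀ j, 0 < x j) (hα : StrictMono α) : (genVandermonde x α).det ≠ 0 :=
  (det_genVandermonde_pos t x α hx hx0 hα).ne'

end Literature.LinearAlgebra.Matrix.GeneralizedVandermonde
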